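import Summits.AnomalousDissipation.AnomalousDissipation.Theorems.SolenoidalFractalHomogenisationLagrangianCarrierConstructionRegularLDistortion
import Summits.AnomalousDissipation.AnomalousDissipation.Theorems.SolenoidalFractalHomogenisationLagrangianCarrierConstructionRegularLLevelBounds
import Summits.AnomalousDissipation.AnomalousDissipation.Theorems.SolenoidalFractalHomogenisationLagrangianCarrierConstructionRegularLReduction
import Summits.AnomalousDissipation.AnomalousDissipation.Theorems.SolenoidalFractalHomogenisationLagrangianCarrierConstructionRegularLHolderCont
import Summits.AnomalousDissipation.AnomalousDissipation.Theorems.SolenoidalFractalHomogenisationLagrangianCarrierConstructionFlowsLRegularT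
import Literature.Analysis.FunctionSpaces.HolderSeries
import HarnessLib

/-!
# K3L `LagrangianCarrierConstruction` (stmt-AnomalousDissipation-24913), line `birth`: the registered stub `stub_regularL` (v8) —
# REGULARITY of the summed Lagrangian carrier under the strain-budget ceiling (`--supports stmt-AnomalousDissipation-24913`)

Summits-side file (everything proved; no definitions, no named facts). `stub_regularL` BY NAME AND SIGNATURE (skeleton r23 v8,
`ledger skeleton check` registry of stmt-AnomalousDissipation-24913): for every design `W` there is a ceiling `θs = θs(k, W) > 0` such that every
Lagrangian lattice carrier with design `W`, `θ₀ ≤ θs`, permissible bookkeeping, `IsLagrangian`, the eleven qualitative clauses of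
`LevelRegular`, commensurable nested windows (W1)/(W2), strain (S), separation `N_m² ≤ N_{m+1}`, θ-template (T4) and amplitude decay (DEC)
is `Regular`. Assembly:
1. the DISTORTION TOWER (`…RegularLDistortion.distortion_tower`): `‖DΦ_m − I‖ ≤ 1/10`, `Lip DΦ_m ≤ 3Lθ₀N_m²` on the refresh windows, with
   `θs = min (1, 1/(60M+1), 1/(66 L U + 1))`, `M = 3√3k`, `U = k/(2π)`, `L = L_W` (`…RegularLLevelC2.exists_levelHessianConst`);
2. LEVEL BOUNDS (`…RegularLLevelBounds`): `‖b_{m+1}‖_∞ ≤ (11/10) U a/N ≤ c₁ N^{−α₁}`, `Lip b_{m+1} ≤ c₂ a ≤ c₂ N^{1−α₁}` (`α₁ = min α₀ 1`);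
3. HÖLDER INTERPOLATION at `r = α₁/2` (`HolderSeries.eBoundedHolderNorm_le_of_norm_le_of_lipschitzWith`): `‖b_{m+1} t‖_{C^{0,r}} ≤ C_H N_{m+1}^{−α₁/2}`,
   summable since `N_{m+1} ≥ 2^{m+1}`;
4. time continuity in `C^{0,r}` (`…RegularLHolderCont`), the common period `refresh 1` transferred from the explicit tower by uniqueness
   (`…FlowsLRegularT`, `…RegularLUnique.isLagrangian_unique`), and the reduction `…RegularLReduction.regular_of_levelBounds`.
This closes the last registered stub of the K3L line `birth` (stub_bookkeepingL p611052, stub_flowsL p622977). It is a construction /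
regularity statement about the route's carrier — infrastructure for route-1's rung leaf F-D1.A0, a FRONTIER FORMAL rung; anomalous
dissipation is NOT claimed. [cite: ArmstrongVicol2025, Thm. 1.1 (regularity class of the carrier), §2.2 (PDF p. 18), Prop. 2.2 / Cor. 2.4 (pp. 19–22), §5.1]
-/

set_option linter.dupNamespace false

noncomputable section

namespace Summit.AnomalousDissipation.AnomalousDissipation.Theorems.SolenoidalFractalHomogenisation.LagrangianCarrierConstruction

open Set Function Filter Topology MeasureTheory
open scoped NNReal ENNReal ContDiff
open Literature.Analysis Literature.Analysis.ODE Literature.Analysis.FunctionSpaces Literature.Analysis.FunctionSpaces.Torus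
open Literature.Analysis.FluidPDE Literature.Analysis.FluidPDE.LatticeShear

variable {k : ℕ}

/-! ## Real-number bookkeeping -/

/-- Scaling of the Hölder interpolation bound: for `N ≥ 1`, `0 < α ≤ 1`,
`c₁ N^{−α} + 2 (c₂ N^{1−α})^{α/2} (2 c₁ N^{−α})^{1−α/2} ≤ (c₁ + 2 c₂^{α/2} (2c₁)^{1−α/2}) N^{−α/2}`. [folklore] -/
theorem holder_interpolation_scaling {c₁ c₂ N α : ℝ} (hc₁ : 0 ≤ c₁) (hc₂ : 0 ≤ c₂) (hN : 1 ≤ N) (hα : 0 < α) :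
    c₁ * N ^ (-α) + 2 * (c₂ * N ^ (1 - α)) ^ (α / 2) * (2 * (c₁ * N ^ (-α))) ^ (1 - α / 2) ≤
      (c₁ + 2 * c₂ ^ (α / 2) * (2 * c₁) ^ (1 - α / 2)) * N ^ (-(α / 2)) := by
  have hN0 : 0 < N := by linarith
  have hNr : ∀ e : ℝ, 0 ≤ N ^ e := fun e => Real.rpow_nonneg hN0.le e
  have h1 : (c₂ * N ^ (1 - α)) ^ (α / 2) = c₂ ^ (α / 2) * N ^ ((1 - α) * (α / 2)) := by
    rw [Real.mul_rpow hc₂ (hNr _), ← Real.rpow_mul hN0.le]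
  have h2 : (2 * (c₁ * N ^ (-α))) ^ (1 - α / 2) = (2 * c₁) ^ (1 - α / 2) * N ^ ((-α) * (1 - α / 2)) := by
    rw [show 2 * (c₁ * N ^ (-α)) = (2 * c₁) * N ^ (-α) by ring, Real.mul_rpow (by positivity) (hNr _), ← Real.rpow_mul hN0.le]
  have h3 : N ^ ((1 - α) * (α / 2)) * N ^ ((-α) * (1 - α / 2)) = N ^ (-(α / 2)) := by
    rw [← Real.rpow_add hN0]; congr 1; ring
  have h4 : N ^ (-α) ≤ N ^ (-(α / 2)) := Real.rpow_le_rpow_of_exponent_le hN (by linarith)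
  rw [h1, h2]
  have hc : 0 ≤ 2 * c₂ ^ (α / 2) * (2 * c₁) ^ (1 - α / 2) := by positivity
  calc c₁ * N ^ (-α) + 2 * (c₂ ^ (α / 2) * N ^ ((1 - α) * (α / 2))) * ((2 * c₁) ^ (1 - α / 2) * N ^ (-α * (1 - α / 2)))
      = c₁ * N ^ (-α) + 2 * c₂ ^ (α / 2) * (2 * c₁) ^ (1 - α / 2) * (N ^ ((1 - α) * (α / 2)) * N ^ (-α * (1 - α / 2))) := by ring
    _ = c₁ * N ^ (-α) + 2 * c₂ ^ (α / 2) * (2 * c₁) ^ (1 - α / 2) * N ^ (-(α / 2)) := by rw [h3]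
    _ ≤ c₁ * N ^ (-(α / 2)) + 2 * c₂ ^ (α / 2) * (2 * c₁) ^ (1 - α / 2) * N ^ (-(α / 2)) := by
        gcongr
    _ = (c₁ + 2 * c₂ ^ (α / 2) * (2 * c₁) ^ (1 - α / 2)) * N ^ (-(α / 2)) := by ring

/-- Super-geometric growth from doubling: `N 0 = 1`, `2 N m ≤ N (m+1)` give `2^m ≤ N m`. [folklore] -/
theorem two_pow_le_N (E : LagrangianLatticeCarrier k) (hN0 : E.N 0 = 1) (hN2 : ∀ m, 2 * E.N m ≤ E.N (m + 1)) (m : ℕ) :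
    2 ^ m ≤ E.N m := by
  induction m with
  | zero => rw [hN0, pow_zero]
  | succ n ih => calc 2 ^ (n + 1) = 2 * 2 ^ n := by ring
      _ ≤ 2 * E.N n := Nat.mul_le_mul_left 2 ih
      _ ≤ E.N (n + 1) := hN2 n

/-! ## The registered stub -/

/-- **K3L `stub_regularL` (skeleton r23 v8), by name and signature.** See the module docstring. [cite: ArmstrongVicol2025, Thm. 1.1 and §2.2 (PDF p. 18), Prop. 2.2 (p. 19), Cor. 2.4 (p. 22), §5.1] -/
theorem stub_regularL : ∀ k (W : Literature.Analysis.FluidPDE.LatticeShear.LatticeWord k), ∃ θs : ℝ, 0 < θs ∧ ∀ (E : Literature.Analysis.FluidPDE.LatticeShear.LagrangianLatticeCarrier k) (θ₀ : ℝ), E.design = W → θ₀ ≤ θs → E.toFractalCarrierData.Permissible → E.IsLagrangian → (∀ m, Continuous (Function.uncurry (E.b (m + 1)))) → (∀ m t, Literature.Analysis.FunctionSpaces.Torus.IsWeaklyDivFree (E.b (m + 1) t)) → (∀ m t, Literature.Analysis.FunctionSpaces.Torus.IsSmooth (E.b (m + 1) t)) → (∀ m (n : ℕ), ∃ C : ℝ,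 ∀ t y, ‖iteratedFDeriv ℝ n (Literature.Analysis.FunctionSpaces.Torus.lift (E.b (m + 1) t)) y‖ ≤ C) → (∀ m, ∃ τ : ℝ, 0 < τ ∧ Function.Periodic (E.b (m + 1)) τ) → (∀ m s, Continuous fun p : ℝ × UnitAddTorus (Fin 3) => E.disp m p.1 s p.2) → (∀ m t s, Literature.Analysis.FunctionSpaces.Torus.IsSmooth (E.disp m t s)) → (∀ m (n : ℕ) (j : ℤ), ∃ C : ℝ, ∀ t ∈ E.window (m + 1) j, ∀ y, ‖iteratedFDeriv ℝ n (Literature.Analysis.FunctionSpaces.Torus.lift (E.disp m t ((j : ℝ) * E.refresh (m + 1)))) y‖ ≤ C) → (∀ m s, E.X m s s = id) → (∀ m t s r, E.X m t s ∘ E.X m s r = E.X m t r) → (∀ m t s, MeasureTheory.MeasurePreserving (E.X m t s) MeasureTheory.volume MeasureTheory.volume) → (∀ m, ∃ r : ℕ, 0 < r ∧ E.refresh (m + 1) = (r : ℝ) * E.toFractalCarrierData.physPeriod (m + 1)) → (∀ m, ∃ q : ℕ, 0 < q ∧ E.refresh m = (q : ℝ) * E.refresh (m + 1)) → (∀ m,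 E.strain m ≤ E.θ (m + 1)) → (∀ m, E.N m ^ 2 ≤ E.N (m + 1)) → (∀ m, E.θ (m + 1) * ((E.N (m + 1) : ℝ) / E.N m) ^ (1 / 16 : ℝ) ≤ θ₀) → (∃ α₀ : ℝ, 0 < α₀ ∧ ∀ m, E.a (m + 1) ≤ ((E.N (m + 1) : ℝ)) ^ (1 - α₀)) → E.Regular := by
  intro k W
  -- design constants: Hessian constant `L = L_W`, gradient `M = 3√3 k`, sup `U = k/(2π)`; the ceiling `θs`
  obtain ⟨L, hL0, hL2W⟩ := exists_levelHessianConst W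
  refine ⟨min 1 (min (1 / (60 * (Real.sqrt 3 * (3 * (k : ℝ))) + 1)) (1 / (66 * (L * ((k : ℝ) / (2 * Real.pi))) + 1))),
    lt_min one_pos (lt_min (by positivity) (by positivity)), ?_⟩
  intro E θ₀ hD hθs hP hLag h1 h2 h3a h3b h4 hF1a hF1b hF1c hF2a hF2b hF2c hW1 hW2 hS hsq hT4 hdec
  set M : ℝ := Real.sqrt 3 * (3 * (k : ℝ)) with hM
  set U : ℝ := (k : ℝ) / (2 * Real.pi) with hU
  have hM0 : 0 ≤ M := by positivity
  have hU0 : 0 ≤ U := by positivity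
  -- bookkeeping consequences
  have hN0 : E.N 0 = 1 := hP.1
  have hN2 : ∀ m, 2 * E.N m ≤ E.N (m + 1) := hP.2.2.1
  have hNpos : ∀ m, (0 : ℝ) < E.N m := fun m => by exact_mod_cast E.toFractalCarrierData.N_pos m
  have hNone : ∀ m, (1 : ℝ) ≤ E.N m := fun m => by exact_mod_cast E.toFractalCarrierData.N_pos m
  have hNmono : ∀ m, (E.N m : ℝ) ≤ E.N (m + 1) := fun m => by
    have h : (2 : ℝ) * E.N m ≤ E.N (m + 1) := by exact_mod_cast hN2 m
    linarith [hNpos m]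
  have hratio : ∀ m, (1 : ℝ) ≤ ((E.N (m + 1) : ℝ) / E.N m) ^ (1 / 16 : ℝ) := fun m =>
    Real.one_le_rpow ((one_le_div (hNpos m)).2 (hNmono m)) (by norm_num)
  have hθ : ∀ m, E.θ (m + 1) ≤ θ₀ := fun m => by
    have h := hT4 m
    have hθp := E.θ_pos (m + 1)
    calc E.θ (m + 1) = E.θ (m + 1) * 1 := (mul_one _).symm
      _ ≤ E.θ (m + 1) * ((E.N (m + 1) : ℝ) / E.N m) ^ (1 / 16 : ℝ) := mul_le_mul_of_nonneg_left (hratio m) hθp.le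
      _ ≤ θ₀ := h
  have hθ0 : 0 < θ₀ := (E.θ_pos 1).trans_le (hθ 0)
  -- the ceiling
  have hθ1 : θ₀ ≤ 1 := hθs.trans (min_le_left _ _)
  have hθM : 60 * (M * θ₀) ≤ 1 := by
    have h : θ₀ ≤ 1 / (60 * M + 1) := hθs.trans ((min_le_right _ _).trans (min_le_left _ _))
    rw [le_div_iff₀ (by positivity)] at h
    nlinarith
  have hθL : 66 * (L * U * θ₀) ≤ 1 := by
    have h : θ₀ ≤ 1 / (66 * (L * U) + 1) := hθs.trans ((min_le_right _ _).trans (min_le_right _ _))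
    rw [le_div_iff₀ (by positivity)] at h
    nlinarith [mul_nonneg hL0 hU0]
  have hL2 : ∀ (m : ℕ) (t : ℝ) (z : EuclideanSpace ℝ (Fin 3)),
      ‖iteratedFDeriv ℝ 2 (fun z : EuclideanSpace ℝ (Fin 3) => E.toFractalCarrierData.level m t (proj z)) z‖ ≤ L * E.a m * E.N m :=
    hL2W E.toFractalCarrierData hD
  -- 1. the distortion tower
  have tower := distortion_tower E θ₀ hLag h1 h3a h3b hF1a hF1b hW2 hS hθ hN0 hN2 hsq hL0 hL2 hθ1 hθM hθL
  -- 2. level bounds: sup and Lipschitz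
  have hsup0 : ∀ m t x, ‖E.b (m + 1) t x‖ ≤ (1 + 1 / 10) * (k * E.a (m + 1) / (2 * Real.pi * E.N (m + 1))) := fun m t x =>
    norm_b_succ_le_of_distortion E m hLag h1 h3a h3b hF1a hF1b (δ := 1 / 10)
      (fun j t ht z => (tower m j _ t (left_mem_window E (m + 1) j) ht).2.1 z) t x
  have hΓ0 : ∀ m, 0 ≤ 3 * L * θ₀ * (E.N m : ℝ) ^ 2 := fun m => by positivity
  have hlip0 : ∀ m t, LipschitzWith (Real.toNNReal ((1 + 1 / 10) * (3 * L * θ₀ * (E.N m : ℝ) ^ 2 *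
      (k * E.a (m + 1) / (2 * Real.pi * E.N (m + 1))) + (1 + 1 / 10) * (Real.sqrt 3 * (3 * (k * E.a (m + 1)))))) *
      holderLiftConst (Fin 3) 1) (E.b (m + 1) t) := fun m t =>
    lipschitzWith_b_succ_of_distortion E m hLag h1 h3a h3b hF1a hF1b (δ := 1 / 10) (hΓ0 m)
      (fun j s t hs ht z => (tower m j s t hs ht).2.1 z)
      (fun j t ht z z' => (tower m j _ t (left_mem_window E (m + 1) j) ht).2.2 z z') t
  -- the amplitude decay with `α₁ = min α₀ 1 ∈ (0, 1]`
  obtain ⟨α₀, hα₀, hdec'⟩ := hdec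
  set α₁ : ℝ := min α₀ 1 with hα₁
  have hα₁0 : 0 < α₁ := lt_min hα₀ one_pos
  have hα₁1 : α₁ ≤ 1 := min_le_right _ _
  have hdec₁ : ∀ m, E.a (m + 1) ≤ (E.N (m + 1) : ℝ) ^ (1 - α₁) := fun m =>
    (hdec' m).trans (Real.rpow_le_rpow_of_exponent_le (hNone _) (by linarith [min_le_left α₀ 1]))
  -- constants of the two bounds in the form `c₁ N^{-α₁}`, `c₂ N^{1-α₁}`
  set c₁ : ℝ := (1 + 1 / 10) * U with hc₁
  set c₂ : ℝ := (1 + 1 / 10) * (3 * L * θ₀ * U + (1 + 1 / 10) * M) * (holderLiftConst (Fin 3) 1 : ℝ) with hc₂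
  have hc₁0 : 0 ≤ c₁ := by positivity
  have hc₂0 : 0 ≤ c₂ := by positivity
  have hsup1 : ∀ m t x, ‖E.b (m + 1) t x‖ ≤ c₁ * (E.N (m + 1) : ℝ) ^ (-α₁) := by
    intro m t x
    have hN := hNpos (m + 1)
    have hq : E.a (m + 1) / E.N (m + 1) ≤ (E.N (m + 1) : ℝ) ^ (-α₁) := by
      rw [div_le_iff₀ hN]
      have e : (E.N (m + 1) : ℝ) ^ (-α₁) * E.N (m + 1) = (E.N (m + 1) : ℝ) ^ (1 - α₁) := by
        rw [show (1 : ℝ) - α₁ = -α₁ + 1 by ring, Real.rpow_add hN, Real.rpow_one]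
      rw [e]; exact hdec₁ m
    calc ‖E.b (m + 1) t x‖ ≤ (1 + 1 / 10) * (k * E.a (m + 1) / (2 * Real.pi * E.N (m + 1))) := hsup0 m t x
      _ = c₁ * (E.a (m + 1) / E.N (m + 1)) := by rw [hc₁, hU]; ring
      _ ≤ c₁ * (E.N (m + 1) : ℝ) ^ (-α₁) := mul_le_mul_of_nonneg_left hq hc₁0
  have hlip1 : ∀ m t, LipschitzWith (Real.toNNReal (c₂ * (E.N (m + 1) : ℝ) ^ (1 - α₁))) (E.b (m + 1) t) := by
    intro m t
    refine (hlip0 m t).weaken ?_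
    have hN := hNpos (m + 1)
    have ha := E.toFractalCarrierData.a_pos (m + 1)
    have hrat : (E.N m : ℝ) ^ 2 / E.N (m + 1) ≤ 1 := (div_le_one hN).2 (by exact_mod_cast hsq m)
    have hreal : (1 + 1 / 10) * (3 * L * θ₀ * (E.N m : ℝ) ^ 2 * (k * E.a (m + 1) / (2 * Real.pi * E.N (m + 1))) +
        (1 + 1 / 10) * (Real.sqrt 3 * (3 * (k * E.a (m + 1))))) ≤
        (1 + 1 / 10) * (3 * L * θ₀ * U + (1 + 1 / 10) * M) * E.a (m + 1) := by
      have e1 : 3 * L * θ₀ * (E.N m : ℝ) ^ 2 * (k * E.a (m + 1) / (2 * Real.pi * E.N (m + 1))) =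
          3 * L * θ₀ * U * E.a (m + 1) * ((E.N m : ℝ) ^ 2 / E.N (m + 1)) := by rw [hU]; field_simp
      have e2 : Real.sqrt 3 * (3 * (k * E.a (m + 1))) = M * E.a (m + 1) := by rw [hM]; ring
      rw [e1, e2]
      have hx : 3 * L * θ₀ * U * E.a (m + 1) * ((E.N m : ℝ) ^ 2 / E.N (m + 1)) ≤ 3 * L * θ₀ * U * E.a (m + 1) * 1 :=
        mul_le_mul_of_nonneg_left hrat (by positivity)
      nlinarith [mul_nonneg hM0 ha.le]
    have hpos : 0 ≤ (1 + 1 / 10) * (3 * L * θ₀ * (E.N m : ℝ) ^ 2 * (k * E.a (m + 1) / (2 * Real.pi * E.N (m + 1))) +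
        (1 + 1 / 10) * (Real.sqrt 3 * (3 * (k * E.a (m + 1))))) := by positivity
    rw [← NNReal.coe_le_coe, NNReal.coe_mul, Real.coe_toNNReal _ hpos, Real.coe_toNNReal _ (by positivity)]
    calc _ ≤ (1 + 1 / 10) * (3 * L * θ₀ * U + (1 + 1 / 10) * M) * E.a (m + 1) * (holderLiftConst (Fin 3) 1 : ℝ) :=
          mul_le_mul_of_nonneg_right hreal (NNReal.coe_nonneg _)
      _ = c₂ * E.a (m + 1) := by rw [hc₂]; ring
      _ ≤ c₂ * (E.N (m + 1) : ℝ) ^ (1 - α₁) := mul_le_mul_of_nonneg_left (hdec₁ m) hc₂0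
  -- 3. Hölder interpolation at `r = α₁/2`
  set r : ℝ≥0 := ⟨α₁ / 2, by linarith⟩ with hr
  have hrr : (r : ℝ) = α₁ / 2 := rfl
  have hr0 : 0 < r := by rw [← NNReal.coe_pos, hrr]; linarith
  have hr1 : r < 1 := by rw [← NNReal.coe_lt_one, hrr]; linarith
  set CH : ℝ := c₁ + 2 * c₂ ^ (α₁ / 2) * (2 * c₁) ^ (1 - α₁ / 2) with hCH
  have hCH1 : c₁ ≤ CH := by
    have : 0 ≤ 2 * c₂ ^ (α₁ / 2) * (2 * c₁) ^ (1 - α₁ / 2) := by positivity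
    rw [hCH]; linarith
  have hCH0 : 0 ≤ CH := hc₁0.trans hCH1
  set ρ : ℕ → ℝ := fun m => CH * (E.N (m + 1) : ℝ) ^ (-(α₁ / 2)) with hρ
  have hρ0 : ∀ m, 0 ≤ ρ m := fun m => mul_nonneg hCH0 (Real.rpow_nonneg (hNpos _).le _)
  have hhol : ∀ m t, eBoundedHolderNorm r (E.b (m + 1) t) ≤ ENNReal.ofReal (ρ m) := by
    intro m t
    have hN1 := hNone (m + 1)
    have hM₀ : ∀ x, ‖E.b (m + 1) t x‖ ≤ Real.toNNReal (c₁ * (E.N (m + 1) : ℝ) ^ (-α₁)) := fun x =>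
      (hsup1 m t x).trans (Real.le_coe_toNNReal _)
    have h := eBoundedHolderNorm_le_of_norm_le_of_lipschitzWith hM₀ (hlip1 m t) hr1.le
    refine h.trans ?_
    rw [← ENNReal.ofReal_coe_nnreal]
    refine ENNReal.ofReal_le_ofReal ?_
    have hx0 : 0 ≤ c₁ * (E.N (m + 1) : ℝ) ^ (-α₁) := mul_nonneg hc₁0 (Real.rpow_nonneg (hNpos _).le _)
    have hy0 : 0 ≤ c₂ * (E.N (m + 1) : ℝ) ^ (1 - α₁) := mul_nonneg hc₂0 (Real.rpow_nonneg (hNpos _).le _)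
    push_cast
    rw [Real.coe_toNNReal _ hx0, Real.coe_toNNReal _ hy0, hrr]
    rw [hρ]
    exact holder_interpolation_scaling hc₁0 hc₂0 hN1 hα₁0
  have hsup : ∀ m t x, ‖E.b (m + 1) t x‖ ≤ ρ m := by
    intro m t x
    refine (hsup1 m t x).trans ?_
    rw [hρ]
    have h1' : (E.N (m + 1) : ℝ) ^ (-α₁) ≤ (E.N (m + 1) : ℝ) ^ (-(α₁ / 2)) :=
      Real.rpow_le_rpow_of_exponent_le (hNone _) (by linarith)
    calc c₁ * (E.N (m + 1) : ℝ) ^ (-α₁) ≤ c₁ * (E.N (m + 1) : ℝ) ^ (-(α₁ / 2)) := mul_le_mul_of_nonneg_left h1' hc₁0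
      _ ≤ CH * (E.N (m + 1) : ℝ) ^ (-(α₁ / 2)) := mul_le_mul_of_nonneg_right hCH1 (Real.rpow_nonneg (hNpos _).le _)
  -- summability: `N (m+1) ≥ 2^{m+1}`
  have hρsum : Summable ρ := by
    set q : ℝ := (2 : ℝ) ^ (-(α₁ / 2)) with hq
    have hq0 : 0 ≤ q := Real.rpow_nonneg (by norm_num) _
    have hq1 : q < 1 := Real.rpow_lt_one_of_one_lt_of_neg (by norm_num) (by linarith)
    have hgeo : Summable fun m : ℕ => CH * q * q ^ m := (summable_geometric_of_lt_one hq0 hq1).mul_left (CH * q)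
    refine Summable.of_nonneg_of_le hρ0 (fun m => ?_) hgeo
    have h2m : (2 : ℝ) ^ (m + 1) ≤ E.N (m + 1) := by exact_mod_cast two_pow_le_N E hN0 hN2 (m + 1)
    have hle : (E.N (m + 1) : ℝ) ^ (-(α₁ / 2)) ≤ ((2 : ℝ) ^ (m + 1)) ^ (-(α₁ / 2)) :=
      Real.rpow_le_rpow_of_nonpos (by positivity) h2m (by linarith)
    have e : ((2 : ℝ) ^ (m + 1)) ^ (-(α₁ / 2)) = q * q ^ m := by
      rw [hq, ← Real.rpow_natCast 2 (m + 1), ← Real.rpow_mul (by norm_num), mul_comm, Real.rpow_mul (by norm_num),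
        Real.rpow_natCast, pow_succ']
    rw [hρ]
    calc CH * (E.N (m + 1) : ℝ) ^ (-(α₁ / 2)) ≤ CH * ((2 : ℝ) ^ (m + 1)) ^ (-(α₁ / 2)) := mul_le_mul_of_nonneg_left hle hCH0
      _ = CH * q * q ^ m := by rw [e]; ring
  -- 4. time continuity in `C^{0,r}`, the common period, and the reduction
  have hcont : ∀ m t₀, Tendsto (fun t => eBoundedHolderNorm r (E.b (m + 1) t - E.b (m + 1) t₀)) (𝓝 t₀) (𝓝 0) := fun m t₀ =>
    tendsto_eBoundedHolderNorm_sub (E.b (m + 1)) (h1 m) (h3a m) (h3b m 1) hr1 t₀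
  obtain ⟨E', hdata, hR, -, hLag', h1', -, h3a', h3b', -, hF1a', -, -, -, -, -, hper'⟩ :=
    exists_isLagrangian_levelRegular_T k E hW1 hW2
  have heq := (isLagrangian_unique E E' hdata hR hLag hLag' h1 h3a h3b hF1a h1' h3a' h3b' hF1a').1
  have hper : ∀ m, Function.Periodic (E.b (m + 1)) (E.refresh 1) := fun m => by rw [← heq m]; exact hper' m
  exact regular_of_levelBounds E h1 h2 h3a h3b h4 hF1a hF1b hF1c hF2a hF2b hF2c (E.refresh_pos 1) hper hr0 hρ0 hρsum
    hsup hhol hcont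

end Summit.AnomalousDissipation.AnomalousDissipation.Theorems.SolenoidalFractalHomogenisation.LagrangianCarrierConstruction

end
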